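import Summits.ValiantsHypothesis.ValiantsHypothesis.Theses.DetQP
import Literature.Barriers.ValiantsHypothesis.CharacteristicTwo
import Literature.Computability.AlgebraicComplexity.PermanentVsDeterminantProofs
import Literature.Computability.AlgebraicComplexity.AlperBogartVelascoProofs
import Literature.Computability.AlgebraicComplexity.DeterminantalComplexityProofs
import Literature.Computability.AlgebraicComplexity.StandardFamiliesProofs
import Literature.LinearAlgebra.Matrix.PermanentLaplace

/-!
# `DetqpThesis` (stmt-ValiantsHypothesis-0315) — negative lemmas: the killed VARIANTS of `X`

Crux work file `Cruxes/DetqpThesis/Disproof.lean` §(A)–(D), landed.  The crux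
`X = ¬ IsQPBounded (n ↦ dc(per_n over ℂ))` (Extended Valiant Hypothesis in dc form) has no
hypotheses; its parameters are the field, the family and the growth class, and each is
load-bearing — the corresponding variant of `X` is FALSE:

* (A) field: `isQPBounded_dcPer_of_charTwo`, `not_forall_field_not_isQPBounded_dcPer` — over a
  field of characteristic 2, `n ↦ dc(per_n)` IS qp-bounded (`per = det`, template constant `c = 1`);
* (B) family: `isQPBounded_dc_detPoly` — `n ↦ dc(det_n)` over `ℂ` is qp-bounded;
* (C) growth: `dcPer_lt_two_pow` (`dc(per_n) < 2^n` for EVERY `n`), so the simply-exponential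
  strengthening `∃ n, 2^n ≤ dc(per_n)` is false (`not_exists_two_pow_le_dcPer`); exact small values
  `dc(per_0) = 0`, `dc(per_1) = 1`, `dc(per_2) = 2`, `dc(per_3) = 7`, `9 ≤ dc(per_4) ≤ 15`, whence
  "Grenet's `2^n - 1` is optimal for all `n ≥ 1`" is false at `n = 2` (`not_grenet_optimal_from_one`);
  `dcPer_monotone` (`per_m` is a projection of `per_{m+1}`, `isProjection_perPoly_succ`), whence
  `9 ≤ dc(per_n)` for all `n ≥ 4`;
* (D) template constant: `qpBound_lt_dcPer_three` — the instances `c ≤ 1` of a qp bound are refuted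
  at `n = 3`, so `detqpThesis_iff_two_le`: `X ↔ ∀ c ≥ 2, ∃ n, 2^{(log₂ n + c)^c} < dc(per_n)`; and
  `c_two_window`: the `c = 2` template exceeds the Mignon–Ressayre floor for every `n` and stays
  below Grenet's ceiling for every `n ≥ 65` — the weakest open instance of `X` is undecided by both
  in-tree bounds.
* (G) base change: `dcPer_le_of_ringHom` — `dc_K(per_n) ≤ dc_L(per_n)` along any ring map
  `L → K`; so the crux over `ℂ` implies `X` over `ℤ, ℚ, ℝ, ℚ̄` (`not_isQPBounded_dcPer_of_ringHom`,
  `detqpThesis_rat_real`): the `ℂ` instance is the strongest characteristic-0 one.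
No statement here asserts a Theses decl; all are inline over existing tree decls. [folklore]
-/

noncomputable section

namespace Summit.ValiantsHypothesis.Theorems.DetqpThesis.Negative

open Summit.ValiantsHypothesis.ValiantsHypothesis.Theses (DetQP.DetqpThesis)

open Literature.Computability.AlgebraicComplexity Literature.Barriers.ValiantsHypothesis
open MvPolynomial

/-! ### Tools -/

/-- A function bounded by the identity is qp-bounded with template constant `c = 1`
(`n < 2^{log₂ n + 1}`). [folklore] -/
theorem isQPBounded_of_le_id {t : ℕ → ℕ} (h : ∀ n, t n ≤ n) : IsQPBounded t :=
  ⟨1, fun n => (h n).trans (by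
    simpa [pow_one] using (Nat.lt_pow_succ_log_self Nat.one_lt_two n).le)⟩

/-- The constant `1` is the determinant of the empty matrix: `HasDetRepr 1 0`. [folklore] -/
theorem hasDetRepr_one_zero {k : Type*} [CommRing k] {σ : Type*} :
    HasDetRepr (1 : MvPolynomial σ k) 0 :=
  ⟨0, fun i => i.elim0, Matrix.det_isEmpty⟩

/-! ### (A) The field is load-bearing -/

/-- In characteristic 2, `dc(per_n) ≤ n` (`per = det`), hence `n ↦ dc(per_n)` is qp-bounded: the
characteristic-2 version of the crux is FALSE. [cite: BurgisserClausenShokrollahi1997, Rem. (21.16)(1)] -/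
theorem isQPBounded_dcPer_of_charTwo (k : Type*) [Field k] [CharP k 2] :
    IsQPBounded (fun n => determinantalComplexity (perPoly (Fin n) k)) :=
  isQPBounded_of_le_id fun n => determinantalComplexity_perPoly_le_of_charTwo k n

/-- No field-uniform form of the crux holds (witness `𝔽₂`): any proof of `X` must use `char ℂ ≠ 2`.
[cite: BurgisserClausenShokrollahi1997, Rem. (21.16)(1)] -/
theorem not_forall_field_not_isQPBounded_dcPer :
    ¬ ∀ (k : Type) [Field k], ¬ IsQPBounded (fun n => determinantalComplexity (perPoly (Fin n) k)) :=
  fun h => h (ZMod 2) (isQPBounded_dcPer_of_charTwo (ZMod 2))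

/-! ### (B) The family is load-bearing -/

/-- `dc(det_n) ≤ n`, so `n ↦ dc(det_n)` over `ℂ` IS qp-bounded: the crux with `det` for `per` is
false; a proof must use per-specific structure. [folklore] -/
theorem isQPBounded_dc_detPoly :
    IsQPBounded (fun n => determinantalComplexity (detPoly (Fin n) ℂ)) :=
  isQPBounded_of_le_id fun n => determinantalComplexity_detPoly_le n

/-! ### (C) Growth class and exact small values -/

/-- `dc(per_0) = 0` (`per_0 = 1` is the empty determinant). [folklore] -/
theorem dcPer_zero : determinantalComplexity (perPoly (Fin 0) ℂ) = 0 := by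
  have h1 : perPoly (Fin 0) ℂ = 1 := by simp [perPoly, Matrix.permanent]
  rw [h1]
  exact Nat.le_zero.1 (determinantalComplexity_le_of_hasDetRepr hasDetRepr_one_zero)

/-- `dc(per_1) = 1`. [folklore] -/
theorem dcPer_one : determinantalComplexity (perPoly (Fin 1) ℂ) = 1 := by
  apply le_antisymm
  · refine determinantalComplexity_le_of_hasDetRepr ⟨Matrix.of fun _ _ => X (0, 0), ?_, ?_⟩
    · intro i j; simp [totalDegree_X]
    · rw [Matrix.det_unique]
      simp [perPoly, Matrix.permanent, Matrix.mvPolynomialX_apply]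
  · have h := totalDegree_le_determinantalComplexity_holds (perPoly (Fin 1) ℂ)
    rwa [totalDegree_perPoly_holds] at h

/-- `per_2 = det [[x₀₀, -x₀₁], [x₁₀, x₁₁]]`: `HasDetRepr per_2 2`. [folklore] -/
theorem hasDetRepr_perPoly_two : HasDetRepr (perPoly (Fin 2) ℂ) 2 := by
  refine ⟨!![X (0, 0), -X (0, 1); X (1, 0), X (1, 1)], fun i j => ?_, ?_⟩
  · fin_cases i <;> fin_cases j <;> simp [totalDegree_X, totalDegree_neg]
  · have hper2 : perPoly (Fin 2) ℂ = X (0, 0) * X (1, 1) + X (0, 1) * X (1, 0) := by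
      simp [perPoly, Matrix.permanent_fin_two_row]
    rw [Matrix.det_fin_two, hper2]
    simp

/-- `dc(per_2) = 2` — strictly BELOW Grenet's `2² - 1 = 3`. [folklore] -/
theorem dcPer_two : determinantalComplexity (perPoly (Fin 2) ℂ) = 2 := by
  apply le_antisymm (determinantalComplexity_le_of_hasDetRepr hasDetRepr_perPoly_two)
  have h := totalDegree_le_determinantalComplexity_holds (perPoly (Fin 2) ℂ)
  rwa [totalDegree_perPoly_holds] at h

/-- `dc(per_3) = 7` (Alper–Bogart–Velasco, proved in tree). [cite: AlperBogartVelasco2017, Corollary 1.4] -/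
theorem dcPer_three : determinantalComplexity (perPoly (Fin 3) ℂ) = 7 :=
  (alperBogartVelasco2017_cor_1_4_complex alperBogartVelasco2017_cor_1_4_holds).1

/-- `9 ≤ dc(per_4) ≤ 15` — the first open value (ABV17 floor, Grenet ceiling). [cite: AlperBogartVelasco2017, Corollary 1.4] -/
theorem dcPer_four_mem :
    9 ≤ determinantalComplexity (perPoly (Fin 4) ℂ) ∧ determinantalComplexity (perPoly (Fin 4) ℂ) ≤ 15 :=
  ⟨(alperBogartVelasco2017_cor_1_4_complex alperBogartVelasco2017_cor_1_4_holds).2,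
    by simpa using determinantalComplexity_perPoly_le_holds ℂ 4 (by norm_num)⟩

/-- **The "squared" floor `n² ≤ dc(per_n)` (twice Mignon–Ressayre) FAILS at `n = 2, 3, 4`**:
`dc(per_2) = 2 < 4`, `dc(per_3) = 7 < 9`, `dc(per_4) ≤ 15 < 16`.  Any superquadratic floor
`n^{2+ε} ≤ dc(per_n)` (crux `DetqpSuperquadratic`/`Superquadratic`, 0318) therefore starts at
`n₀ ≥ 5` at the earliest; `n = 5` (`13 ≤ dc(per_5) ≤ 31` vs `25`) is the first undecided case.
[cite: AlperBogartVelasco2017, Corollary 1.4] -/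
theorem dcPer_lt_sq_of_le_four {n : ℕ} (h2 : 2 ≤ n) (h4 : n ≤ 4) :
    determinantalComplexity (perPoly (Fin n) ℂ) < n ^ 2 := by
  interval_cases n
  · rw [dcPer_two]; norm_num
  · rw [dcPer_three]; norm_num
  · have := dcPer_four_mem.2; omega

/-- **`per_m` is a projection of `per_{m+1}`** (border with a unit corner: `x₀₀ ↦ 1`, the rest of
row and column `0` `↦ 0`), so `dc(per_m) ≤ dc(per_{m+1})`. [folklore] -/
theorem isProjection_perPoly_succ (k : Type*) [CommRing k] (m : ℕ) :
    IsProjection (perPoly (Fin m) k) (perPoly (Fin (m + 1)) k) := by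
  classical
  let a : Fin (m + 1) × Fin (m + 1) → MvPolynomial (Fin m × Fin m) k := fun p =>
    Fin.cases (Fin.cases (C 1) (fun _ => C 0) p.2)
      (fun i => Fin.cases (C 0) (fun j => X (i, j)) p.2) p.1
  have ha00 : a (0, 0) = C 1 := by simp [a]
  have ha0s : ∀ j : Fin m, a (0, j.succ) = C 0 := fun j => by simp [a]
  have has0 : ∀ i : Fin m, a (i.succ, 0) = C 0 := fun i => by simp [a]
  have hass : ∀ i j : Fin m, a (i.succ, j.succ) = X (i, j) := fun i j => by simp [a]
  refine ⟨a, fun p => ?_, ?_⟩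
  · obtain ⟨i, j⟩ := p
    refine Fin.cases ?_ (fun i' => ?_) i <;> refine Fin.cases ?_ (fun j' => ?_) j
    · exact Or.inr ⟨1, ha00⟩
    · exact Or.inr ⟨0, ha0s j'⟩
    · exact Or.inr ⟨0, has0 i'⟩
    · exact Or.inl ⟨(i', j'), hass i' j'⟩
  · have h : aeval a (perPoly (Fin (m + 1)) k) = (Matrix.of fun i j => a (i, j)).permanent := by
      simp [perPoly, Matrix.permanent, map_sum, map_prod]
    rw [h, Matrix.permanent_eq_sum_row_zero, Fin.sum_univ_succ]
    have hsub : (Matrix.of fun i j => a (i, j)).submatrix Fin.succ (Fin.succAbove 0) =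
        Matrix.mvPolynomialX (Fin m) (Fin m) k := by
      ext i j
      simp [Matrix.mvPolynomialX_apply, Fin.succAbove_zero, hass]
    simp only [Matrix.of_apply, ha00, ha0s, C_0, zero_mul, Finset.sum_const_zero, add_zero, C_1,
      one_mul, hsub]
    rfl

/-- `dc(per_m) ≤ dc(per_{m+1})` over any commutative ring. [folklore] -/
theorem dcPer_le_succ (k : Type*) [CommRing k] (m : ℕ) :
    determinantalComplexity (perPoly (Fin m) k) ≤ determinantalComplexity (perPoly (Fin (m + 1)) k) :=
  determinantalComplexity_le_of_isProjection_holds (isProjection_perPoly_succ k m)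

/-- **`n ↦ dc(per_n)` is monotone.**  Consequence for the crux: lower bounds propagate upwards
(`9 ≤ dc(per_n)` for all `n ≥ 4`, `nine_le_dcPer`), and in the infinitely-often form of `X` one may
restrict to any cofinal set of `n`... but only downwards in value, never turning i.o. into a.e.
[folklore] -/
theorem dcPer_monotone (k : Type*) [CommRing k] :
    Monotone fun n => determinantalComplexity (perPoly (Fin n) k) :=
  monotone_nat_of_le_succ (dcPer_le_succ k)

/-- `9 ≤ dc(per_n)` for every `n ≥ 4` (ABV17 at `n = 4` + monotonicity; beats Mignon–Ressayre
`⌈n²/2⌉` only at `n = 4`). [cite: AlperBogartVelasco2017, Corollary 1.4] -/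
theorem nine_le_dcPer {n : ℕ} (hn : 4 ≤ n) : 9 ≤ determinantalComplexity (perPoly (Fin n) ℂ) :=
  dcPer_four_mem.1.trans (dcPer_monotone ℂ hn)

/-- Grenet's ceiling in strict form, valid for EVERY `n` (including `n = 0`): `dc(per_n) < 2^n`.
[cite: Grenet2011, Thm. 1] -/
theorem dcPer_lt_two_pow (n : ℕ) : determinantalComplexity (perPoly (Fin n) ℂ) < 2 ^ n := by
  rcases Nat.eq_zero_or_pos n with rfl | hn
  · rw [dcPer_zero]; norm_num
  · have h := determinantalComplexity_perPoly_le_holds ℂ n hn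
    have : 1 ≤ 2 ^ n := Nat.one_le_two_pow
    omega

/-- **The simply-exponential strengthening of `X` is false**: there is NO `n` with
`2^n ≤ dc(per_n)`. [cite: Grenet2011, Thm. 1] -/
theorem not_exists_two_pow_le_dcPer : ¬ ∃ n, 2 ^ n ≤ determinantalComplexity (perPoly (Fin n) ℂ) :=
  fun ⟨n, hn⟩ => absurd hn (not_le.mpr (dcPer_lt_two_pow n))

/-- **"Grenet is optimal for every `n ≥ 1`" is false** — at `n = 2`, `dc(per_2) = 2 < 3 = 2² - 1`
(true at `n = 1, 3`; open from `n = 4`). [folklore] -/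
theorem not_grenet_optimal_from_one :
    ¬ ∀ n, 1 ≤ n → determinantalComplexity (perPoly (Fin n) ℂ) = 2 ^ n - 1 := by
  intro h
  have h2 := h 2 (by norm_num)
  rw [dcPer_two] at h2
  norm_num at h2

/-! ### (D) The template constant -/

/-- `log₂ 3 = 1`. [folklore] -/
theorem log_two_three : Nat.log 2 3 = 1 :=
  Nat.log_eq_of_pow_le_of_lt_pow (by norm_num) (by norm_num)

/-- The instances `c ≤ 1` of a quasi-polynomial bound on `dc(per_n)` are refuted at `n = 3`:
`2^{(log₂ 3 + c)^c} ≤ 4 < 7 = dc(per_3)`. [cite: AlperBogartVelasco2017, Corollary 1.4] -/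
theorem qpBound_lt_dcPer_three {c : ℕ} (hc : c ≤ 1) :
    2 ^ ((Nat.log 2 3 + c) ^ c) < determinantalComplexity (perPoly (Fin 3) ℂ) := by
  rw [dcPer_three, log_two_three]
  interval_cases c <;> norm_num

/-- `X` unfolded: for every template constant `c` some `n` violates the qp bound. [folklore] -/
theorem detqpThesis_iff :
    DetQP.DetqpThesis ↔
      ∀ c : ℕ, ∃ n : ℕ, 2 ^ ((Nat.log 2 n + c) ^ c) < determinantalComplexity (perPoly (Fin n) ℂ) := by
  simp only [DetQP.DetqpThesis, IsQPBounded, not_exists, not_forall, not_le]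

/-- Hence `X ↔` every template constant `c ≥ 2` is violated somewhere: the constants `c ≤ 1` carry
no information. [folklore] -/
theorem detqpThesis_iff_two_le :
    DetQP.DetqpThesis ↔
      ∀ c : ℕ, 2 ≤ c → ∃ n : ℕ, 2 ^ ((Nat.log 2 n + c) ^ c) < determinantalComplexity (perPoly (Fin n) ℂ) := by
  rw [detqpThesis_iff]
  refine ⟨fun h c _ => h c, fun h c => ?_⟩
  rcases Nat.lt_or_ge c 2 with hc | hc
  · exact ⟨3, qpBound_lt_dcPer_three (by omega)⟩
  · exact h c hc

/-- Arithmetic for the `c = 2` window: `(log₂ n + 2)² ≤ n - 1` for all `n ≥ 65`. [folklore] -/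
theorem log_add_two_sq_le {n : ℕ} (hn : 65 ≤ n) : (Nat.log 2 n + 2) ^ 2 ≤ n - 1 := by
  set L := Nat.log 2 n with hL
  have hlow : 2 ^ L ≤ n := Nat.pow_log_le_self 2 (by omega)
  have hup : n < 2 ^ (L + 1) := Nat.lt_pow_succ_log_self Nat.one_lt_two n
  have hL6 : 6 ≤ L := by
    by_contra h6
    have : L + 1 ≤ 6 := by omega
    have : 2 ^ (L + 1) ≤ 2 ^ 6 := Nat.pow_le_pow_right (by norm_num) this
    omega
  rcases hL6.eq_or_lt with h6 | h7
  · rw [← h6]; omega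
  · have key : ∀ m, 7 ≤ m → (m + 2) ^ 2 + 1 ≤ 2 ^ m := by
      intro m hm
      induction m, hm using Nat.le_induction with
      | base => norm_num
      | succ m hm ih =>
        have h2m : 2 * m + 5 ≤ 2 ^ m := by nlinarith
        calc (m + 1 + 2) ^ 2 + 1 = (m + 2) ^ 2 + 1 + (2 * m + 5) := by ring
          _ ≤ 2 ^ m + 2 ^ m := Nat.add_le_add ih h2m
          _ = 2 ^ (m + 1) := by ring
    have := key L h7
    omega

/-- **The `c = 2` window.** (i) For every `n` the `c = 2` template sits ABOVE the Mignon–Ressayre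
floor: `n² < 2 · 2^{(log₂ n + 2)²}`; (ii) for every `n ≥ 65` it sits BELOW Grenet's ceiling
`2^n - 1`.  The weakest open instance of `X` asks for ONE `n` with `dc(per_n) > 2^{(log₂ n + 2)²}`
(e.g. `dc(per_128) > 2^81`), undecided by both in-tree bounds. [folklore] -/
theorem c_two_window (n : ℕ) :
    n ^ 2 < 2 * 2 ^ ((Nat.log 2 n + 2) ^ 2) ∧
      (65 ≤ n → 2 ^ ((Nat.log 2 n + 2) ^ 2) ≤ 2 ^ n - 1) := by
  constructor
  · have hup : n < 2 ^ (Nat.log 2 n + 1) := Nat.lt_pow_succ_log_self Nat.one_lt_two n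
    have h1 : n ^ 2 < (2 ^ (Nat.log 2 n + 1)) ^ 2 := Nat.pow_lt_pow_left hup (by norm_num)
    have h2 : (2 ^ (Nat.log 2 n + 1)) ^ 2 ≤ 2 ^ ((Nat.log 2 n + 2) ^ 2) := by
      rw [← pow_mul]
      exact Nat.pow_le_pow_right (by norm_num) (by nlinarith)
    omega
  · intro hn
    have h := log_add_two_sq_le hn
    have h1 : 2 ^ ((Nat.log 2 n + 2) ^ 2) ≤ 2 ^ (n - 1) := Nat.pow_le_pow_right (by norm_num) h
    have h2 : 2 ^ n = 2 * 2 ^ (n - 1) := by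
      rw [← pow_succ']; congr 1; omega
    have h3 : 1 ≤ 2 ^ (n - 1) := Nat.one_le_two_pow
    omega

/-! ### (G) Base change: the crux over `ℂ` is the strongest characteristic-0 instance -/

/-- Base change only LOWERS `dc`: along any ring map `L → K`, `dc_K(per_n) ≤ dc_L(per_n)`
(map an optimal representation over `L`, `HasDetRepr.map_holds`, `map_perPoly`). [cite: Burgisser2000, §4.1] -/
theorem dcPer_le_of_ringHom {L K : Type*} [CommRing L] [CommRing K] (φ : L →+* K) (n : ℕ) :
    determinantalComplexity (perPoly (Fin n) K) ≤ determinantalComplexity (perPoly (Fin n) L) := by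
  have h := HasDetRepr.map_holds (hasDetRepr_determinantalComplexity_holds (perPoly (Fin n) L)) φ
  rw [map_perPoly] at h
  exact determinantalComplexity_le_of_hasDetRepr h

/-- Hence a qp bound over `L` transfers to every `K` receiving a ring map from `L`. [cite: Burgisser2000, §4.1] -/
theorem isQPBounded_dcPer_of_ringHom {L K : Type*} [CommRing L] [CommRing K] (φ : L →+* K)
    (h : IsQPBounded fun n => determinantalComplexity (perPoly (Fin n) L)) :
    IsQPBounded fun n => determinantalComplexity (perPoly (Fin n) K) := by
  obtain ⟨c, hc⟩ := h
  exact ⟨c, fun n => (dcPer_le_of_ringHom φ n).trans (hc n)⟩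

/-- **The crux over `ℂ` implies `X` over every ring mapping to `ℂ`** (`ℤ`, `ℚ`, number fields,
`ℝ`, `ℚ̄`): `X_ℂ` is the STRONGEST characteristic-0 instance, and conversely only an `X` over an
extension of `ℂ` would imply it.  (By Lefschetz/Nullstellensatz `X_ℂ ↔ X_{ℚ̄}`; not formalised.)
[cite: Burgisser2000, §4.1] -/
theorem not_isQPBounded_dcPer_of_ringHom {L K : Type*} [CommRing L] [CommRing K] (φ : L →+* K)
    (hK : ¬ IsQPBounded fun n => determinantalComplexity (perPoly (Fin n) K)) :
    ¬ IsQPBounded fun n => determinantalComplexity (perPoly (Fin n) L) :=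
  fun hL => hK (isQPBounded_dcPer_of_ringHom φ hL)

/-- In particular the crux gives `X` over `ℚ` and over `ℝ`. [cite: Burgisser2000, §4.1] -/
theorem detqpThesis_rat_real (h : DetQP.DetqpThesis) :
    (¬ IsQPBounded fun n => determinantalComplexity (perPoly (Fin n) ℚ)) ∧
      ¬ IsQPBounded fun n => determinantalComplexity (perPoly (Fin n) ℝ) :=
  ⟨not_isQPBounded_dcPer_of_ringHom (algebraMap ℚ ℂ) h,
    not_isQPBounded_dcPer_of_ringHom (algebraMap ℝ ℂ) h⟩

end Summit.ValiantsHypothesis.Theorems.DetqpThesis.Negative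

end
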